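import Summits.NavierStokesRegularity.NavierStokesRegularity.Theorems.ExtremiserTransienceNearExtremalTransienceExtremiserLiouvilleConstantSpeedSlideCubicBounds
import Summits.NavierStokesRegularity.NavierStokesRegularity.Theorems.ExtremiserTransienceNearExtremalTransienceExtremiserLiouvilleConstantSpeedSlidePalinstrophyCancellation
import Summits.NavierStokesRegularity.NavierStokesRegularity.Theorems.ExtremiserTransienceNearExtremalTransienceExtremiserLiouvilleConstantSpeedSlideInequalityLayer
import HarnessLib

/-!
# Crux `ExtremiserTransience.NearExtremalTransience` (stmt-NavierStokesRegularity-21883), line `extremiser_liouville`,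
# stub K1b — THE `Z′`-BRACKET OF (INEQ)₃ SPLIT INTO ITS NINE DENSITIES (R6b, Z′ half, step 1; record §17/§18)

`--supports stmt-NavierStokesRegularity-21883` (helper).  Author: prover seat `ns-el-k1b` (g9).

In `slideInequality_layer(Step)` the enstrophy `Ens = ∫‖ω‖²` multiplies the palinstrophy variation
`Ĉ₁ = −½∫g′|Dω|²_F − ∫[d₂ + d₃ + d₄ + d₅ + Σᵢ(d₆ᵢ + d₇ᵢ)] + ∫[d₈ + d₉]` (densities listed in record §17).  The `Z′` half of the absorption
ledger starts by splitting these two integrals into the nine named ones; this needs the integrability of every density under the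
hypotheses of (INEQ)₃ (`D¹v, D²v ∈ L²`, `‖v − c‖² ∈ L¹` of the slab, `g‴ = 0` off the slab, bounded `g′, g″, g‴`) — each is a bounded weight
times an `L²·L²` product (`‖D ω‖ ≤ 4‖D²v‖`, `‖∂B‖ ≤ ‖∂v‖`, `‖∂∂B‖ ≤ ‖∂∂v‖`, `‖B‖ ≤ ‖v − c‖` on the slab).
* `integrable_palinstrophyDensity₂ … ₉`-type facts are proved inline; `palinstrophyBracket_eq_split` : the split identity, left-hand side the
  `Ĉ₁` bracket of (INEQ)₃ verbatim.
After the split the identities (P) (p739987), (P)-dir (p740168), the cancellation (p740371), the axial rule for `d₂` (…SlideGenerator), (KIN) for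
`d₄` (p737733) and the bounds of p742367 / p743218 / p743017 apply term by term (record §18).

WHAT THIS IS NOT: K1b is NOT proved; nothing here proves NS regularity. [folklore]
-/

noncomputable section

open Set Filter Topology MeasureTheory Metric Function InnerProductSpace
open scoped ENNReal NNReal Topology InnerProductSpace RealInnerProductSpace ContDiff
open Literature.Analysis.FluidPDE Literature.Analysis

namespace Summit.NavierStokesRegularity.NavierStokesRegularity.Theorems

-- the problem directory repeats the summit name (`NavierStokesRegularity/NavierStokesRegularity`)
set_option linter.dupNamespace false

namespace ExtremiserLiouville

open DepletionLadder.KStar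

variable {v : EuclideanSpace ℝ (Fin 3) → EuclideanSpace ℝ (Fin 3)} {c : EuclideanSpace ℝ (Fin 3)} {g : ℝ → ℝ}

/-- **The `Ĉ₁` bracket of (INEQ)₃ split into its nine integrals.**  `v ∈ C^∞` with `D¹v, D²v ∈ L²`, `g ∈ C^∞` with `g′, g″, g‴`
bounded and `g‴ = 0` on `{|s| ≥ T}`, `‖v − c‖²` integrable on the slab `{|x₂| ≤ T}`. [folklore] -/
theorem palinstrophyBracket_eq_split (hv : ContDiff ℝ ∞ v) (hg : ContDiff ℝ ∞ g) {K1 K2 K3 T : ℝ}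
    (hK1 : ∀ s, |deriv g s| ≤ K1) (hK2 : ∀ s, |deriv (deriv g) s| ≤ K2) (hK3 : ∀ s, |deriv (deriv (deriv g)) s| ≤ K3)
    (hT3 : ∀ s, T ≤ |s| → deriv (deriv (deriv g)) s = 0)
    (h1 : ∫⁻ x, ‖iteratedFDeriv ℝ 1 v x‖ₑ ^ 2 < ⊤) (h2 : ∫⁻ x, ‖iteratedFDeriv ℝ 2 v x‖ₑ ^ 2 < ⊤)
    (hslab : Integrable (fun x => {x : EuclideanSpace ℝ (Fin 3) | |x 2| ≤ T}.indicator (fun x => ‖v x - c‖ ^ 2) x) volume) :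
    (-((1 / 2) * ∫ x, deriv g (x 2) * frobeniusNormSq (fderiv ℝ (curl v) x)) -
          (∫ x, deriv (deriv g) (x 2) * ⟪fderiv ℝ (curl v) x (EuclideanSpace.single (2 : Fin 3) (1 : ℝ)), curl v x⟫ +
        deriv g (x 2) * ‖fderiv ℝ (curl v) x (EuclideanSpace.single (2 : Fin 3) (1 : ℝ))‖ ^ 2 +
        deriv (deriv (deriv g)) (x 2) * ⟪fderiv ℝ (curl v) x (EuclideanSpace.single (2 : Fin 3) (1 : ℝ)),
          (-(v x - c) 1) • EuclideanSpace.single (0 : Fin 3) (1 : ℝ) + ((v x - c) 0) • EuclideanSpace.single (1 : Fin 3) (1 : ℝ)⟫ +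
        deriv (deriv g) (x 2) * ⟪fderiv ℝ (curl v) x (EuclideanSpace.single (2 : Fin 3) (1 : ℝ)),
          fderiv ℝ (fun z : EuclideanSpace ℝ (Fin 3) =>
            (-(v z - c) 1) • EuclideanSpace.single (0 : Fin 3) (1 : ℝ) + ((v z - c) 0) • EuclideanSpace.single (1 : Fin 3) (1 : ℝ)) x
            (EuclideanSpace.single (2 : Fin 3) (1 : ℝ))⟫ +
        ∑ i : Fin 3, (deriv (deriv g) (x 2) * ⟪fderiv ℝ (curl v) x (EuclideanSpace.basisFun (Fin 3) ℝ i),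
            fderiv ℝ (fun z : EuclideanSpace ℝ (Fin 3) =>
              (-(v z - c) 1) • EuclideanSpace.single (0 : Fin 3) (1 : ℝ) + ((v z - c) 0) • EuclideanSpace.single (1 : Fin 3) (1 : ℝ)) x
              (EuclideanSpace.basisFun (Fin 3) ℝ i)⟫ +
          deriv g (x 2) * ⟪fderiv ℝ (curl v) x (EuclideanSpace.basisFun (Fin 3) ℝ i),
            fderiv ℝ (fun y : EuclideanSpace ℝ (Fin 3) => fderiv ℝ (fun z : EuclideanSpace ℝ (Fin 3) =>
              (-(v z - c) 1) • EuclideanSpace.single (0 : Fin 3) (1 : ℝ) + ((v z - c) 0) • EuclideanSpace.single (1 : Fin 3) (1 : ℝ)) y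
              (EuclideanSpace.basisFun (Fin 3) ℝ i)) x (EuclideanSpace.single (2 : Fin 3) (1 : ℝ))⟫)) +
          ∫ x, deriv (deriv g) (x 2) * (fderiv ℝ (curl v) x (EuclideanSpace.single (2 : Fin 3) (1 : ℝ)) 0 * fderiv ℝ v x (EuclideanSpace.single (1 : Fin 3) (1 : ℝ)) 2 -
          fderiv ℝ (curl v) x (EuclideanSpace.single (2 : Fin 3) (1 : ℝ)) 1 * fderiv ℝ v x (EuclideanSpace.single (0 : Fin 3) (1 : ℝ)) 2) +
        deriv g (x 2) * ∑ i : Fin 3, (fderiv ℝ (curl v) x (EuclideanSpace.basisFun (Fin 3) ℝ i) 0 *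
            fderiv ℝ (fun y => fderiv ℝ v y (EuclideanSpace.single (1 : Fin 3) (1 : ℝ))) x (EuclideanSpace.basisFun (Fin 3) ℝ i) 2 -
          fderiv ℝ (curl v) x (EuclideanSpace.basisFun (Fin 3) ℝ i) 1 *
            fderiv ℝ (fun y => fderiv ℝ v y (EuclideanSpace.single (0 : Fin 3) (1 : ℝ))) x (EuclideanSpace.basisFun (Fin 3) ℝ i) 2)) =
    -((1 / 2) * (∫ x : EuclideanSpace ℝ (Fin 3), deriv g (x 2) * frobeniusNormSq (fderiv ℝ (curl v) x))) -
      ((∫ x : EuclideanSpace ℝ (Fin 3), deriv (deriv g) (x 2) * ⟪fderiv ℝ (curl v) x (EuclideanSpace.single (2 : Fin 3) (1 : ℝ)), curl v x⟫) +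
       (∫ x : EuclideanSpace ℝ (Fin 3), deriv g (x 2) * ‖fderiv ℝ (curl v) x (EuclideanSpace.single (2 : Fin 3) (1 : ℝ))‖ ^ 2) +
       (∫ x : EuclideanSpace ℝ (Fin 3), deriv (deriv (deriv g)) (x 2) * ⟪fderiv ℝ (curl v) x (EuclideanSpace.single (2 : Fin 3) (1 : ℝ)),
          (-(v x - c) 1) • EuclideanSpace.single (0 : Fin 3) (1 : ℝ) + ((v x - c) 0) • EuclideanSpace.single (1 : Fin 3) (1 : ℝ)⟫) +
       (∫ x : EuclideanSpace ℝ (Fin 3), deriv (deriv g) (x 2) * ⟪fderiv ℝ (curl v) x (EuclideanSpace.single (2 : Fin 3) (1 : ℝ)),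
          fderiv ℝ (fun z : EuclideanSpace ℝ (Fin 3) => (-(v z - c) 1) • EuclideanSpace.single (0 : Fin 3) (1 : ℝ) + ((v z - c) 0) • EuclideanSpace.single (1 : Fin 3) (1 : ℝ)) x
            (EuclideanSpace.single (2 : Fin 3) (1 : ℝ))⟫) +
       (∫ x : EuclideanSpace ℝ (Fin 3), ∑ i : Fin 3, deriv (deriv g) (x 2) * ⟪fderiv ℝ (curl v) x (EuclideanSpace.basisFun (Fin 3) ℝ i),
            fderiv ℝ (fun z : EuclideanSpace ℝ (Fin 3) => (-(v z - c) 1) • EuclideanSpace.single (0 : Fin 3) (1 : ℝ) + ((v z - c) 0) • EuclideanSpace.single (1 : Fin 3) (1 : ℝ)) x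
              (EuclideanSpace.basisFun (Fin 3) ℝ i)⟫) +
       (∫ x : EuclideanSpace ℝ (Fin 3), ∑ i : Fin 3, deriv g (x 2) * ⟪fderiv ℝ (curl v) x (EuclideanSpace.basisFun (Fin 3) ℝ i),
            fderiv ℝ (fun y : EuclideanSpace ℝ (Fin 3) => fderiv ℝ (fun z : EuclideanSpace ℝ (Fin 3) => (-(v z - c) 1) • EuclideanSpace.single (0 : Fin 3) (1 : ℝ) + ((v z - c) 0) • EuclideanSpace.single (1 : Fin 3) (1 : ℝ)) y
              (EuclideanSpace.basisFun (Fin 3) ℝ i)) x (EuclideanSpace.single (2 : Fin 3) (1 : ℝ))⟫)) +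
      ((∫ x : EuclideanSpace ℝ (Fin 3), deriv (deriv g) (x 2) * (fderiv ℝ (curl v) x (EuclideanSpace.single (2 : Fin 3) (1 : ℝ)) 0 * fderiv ℝ v x (EuclideanSpace.single (1 : Fin 3) (1 : ℝ)) 2 -
          fderiv ℝ (curl v) x (EuclideanSpace.single (2 : Fin 3) (1 : ℝ)) 1 * fderiv ℝ v x (EuclideanSpace.single (0 : Fin 3) (1 : ℝ)) 2)) +
       (∫ x : EuclideanSpace ℝ (Fin 3), deriv g (x 2) * ∑ i : Fin 3, (fderiv ℝ (curl v) x (EuclideanSpace.basisFun (Fin 3) ℝ i) 0 *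
            fderiv ℝ (fun y => fderiv ℝ v y (EuclideanSpace.single (1 : Fin 3) (1 : ℝ))) x (EuclideanSpace.basisFun (Fin 3) ℝ i) 2 -
          fderiv ℝ (curl v) x (EuclideanSpace.basisFun (Fin 3) ℝ i) 1 *
            fderiv ℝ (fun y => fderiv ℝ v y (EuclideanSpace.single (0 : Fin 3) (1 : ℝ))) x (EuclideanSpace.basisFun (Fin 3) ℝ i) 2))) := by
  have hK10 : 0 ≤ K1 := (abs_nonneg _).trans (hK1 0)
  have hK20 : 0 ≤ K2 := (abs_nonneg _).trans (hK2 0)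
  have hK30 : 0 ≤ K3 := (abs_nonneg _).trans (hK3 0)
  have lt2 : (2 : WithTop ℕ∞) ≤ ((⊤ : ℕ∞) : WithTop ℕ∞) := WithTop.coe_le_coe.mpr le_top
  have hv2 : ContDiff ℝ 2 v := hv.of_le lt2
  have hvd : Differentiable ℝ v := hv.differentiable (by simp)
  have hVs : ContDiff ℝ ∞ (fun z => v z - c) := hv.sub contDiff_const
  have hVs2 : ContDiff ℝ 2 (fun z => v z - c) := hVs.of_le lt2
  have hVsd : Differentiable ℝ (fun z => v z - c) := hVs.differentiable (by simp)
  have hBc : ContDiff ℝ ∞ (fun z : EuclideanSpace ℝ (Fin 3) => (-(v z - c) 1) • EuclideanSpace.single (0 : Fin 3) (1 : ℝ) + ((v z - c) 0) • EuclideanSpace.single (1 : Fin 3) (1 : ℝ)) := contDiff_crossField hVs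
  -- base integrable squares
  obtain ⟨iW2, iP2⟩ := integrable_sq_curl_and_fderiv hv h1
  have iQ2 : Integrable (fun x : EuclideanSpace ℝ (Fin 3) => ‖iteratedFDeriv ℝ 2 v x‖ ^ 2) volume :=
    integrable_sq_norm_of_lintegral (hv.continuous_iteratedFDeriv (WithTop.coe_le_coe.mpr le_top)) h2
  -- continuity of the building blocks
  have hg1 : ContDiff ℝ (⊤ : ℕ∞) (deriv g) := by simpa using hg.iterate_deriv 1
  have hg2 : ContDiff ℝ (⊤ : ℕ∞) (deriv (deriv g)) := by simpa using hg.iterate_deriv 2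
  have hg3 : ContDiff ℝ (⊤ : ℕ∞) (deriv (deriv (deriv g))) := by simpa using hg.iterate_deriv 3
  have c2 : Continuous fun x : EuclideanSpace ℝ (Fin 3) => x 2 := PiLp.continuous_apply 2 _ (2 : Fin 3)
  have cg1 : Continuous fun x : EuclideanSpace ℝ (Fin 3) => deriv g (x 2) := hg1.continuous.comp c2
  have cg2 : Continuous fun x : EuclideanSpace ℝ (Fin 3) => deriv (deriv g) (x 2) := hg2.continuous.comp c2
  have cg3 : Continuous fun x : EuclideanSpace ℝ (Fin 3) => deriv (deriv (deriv g)) (x 2) := hg3.continuous.comp c2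
  have cω : Continuous (curl v) := (contDiff_curl (n := ⊤) hv).continuous
  have cDω : ∀ w : EuclideanSpace ℝ (Fin 3), Continuous fun x => fderiv ℝ (curl v) x w := fun w =>
    ((contDiff_curl (n := ⊤) hv).continuous_fderiv (by simp)).clm_apply continuous_const
  have cDωF : Continuous fun x => frobeniusNormSq (fderiv ℝ (curl v) x) := continuous_frobeniusNormSq_fderiv (contDiff_curl (n := ⊤) hv) (by simp)
  have cB : Continuous fun x : EuclideanSpace ℝ (Fin 3) => (-(v x - c) 1) • EuclideanSpace.single (0 : Fin 3) (1 : ℝ) + ((v x - c) 0) • EuclideanSpace.single (1 : Fin 3) (1 : ℝ) := hBc.continuous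
  have cDB : ∀ w : EuclideanSpace ℝ (Fin 3), Continuous fun x => fderiv ℝ (fun z : EuclideanSpace ℝ (Fin 3) => (-(v z - c) 1) • EuclideanSpace.single (0 : Fin 3) (1 : ℝ) + ((v z - c) 0) • EuclideanSpace.single (1 : Fin 3) (1 : ℝ)) x w := fun w => (hBc.continuous_fderiv (by simp)).clm_apply continuous_const
  have cDDB : ∀ (w u : EuclideanSpace ℝ (Fin 3)), Continuous fun x => fderiv ℝ (fun y : EuclideanSpace ℝ (Fin 3) => fderiv ℝ (fun z : EuclideanSpace ℝ (Fin 3) => (-(v z - c) 1) • EuclideanSpace.single (0 : Fin 3) (1 : ℝ) + ((v z - c) 0) • EuclideanSpace.single (1 : Fin 3) (1 : ℝ)) y w) x u := fun w u =>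
    ((((hBc.fderiv_right (m := ∞) (by exact_mod_cast le_rfl)).clm_apply contDiff_const).continuous_fderiv (by simp))).clm_apply continuous_const
  have cDv : ∀ w : EuclideanSpace ℝ (Fin 3), Continuous fun x => fderiv ℝ v x w := fun w => (hv.continuous_fderiv (by simp)).clm_apply continuous_const
  have cHv : ∀ (w u : EuclideanSpace ℝ (Fin 3)), Continuous fun x => fderiv ℝ (fun y => fderiv ℝ v y w) x u := fun w u =>
    ((((hv.fderiv_right (m := ∞) (by exact_mod_cast le_rfl)).clm_apply contDiff_const).continuous_fderiv (by simp))).clm_apply continuous_const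
  have cco : ∀ {f : EuclideanSpace ℝ (Fin 3) → EuclideanSpace ℝ (Fin 3)} (i : Fin 3), Continuous f → Continuous fun x => f x i := fun i hf =>
    (EuclideanSpace.proj i : EuclideanSpace ℝ (Fin 3) →L[ℝ] ℝ).continuous.comp hf
  -- norm bookkeeping
  have nb : ∀ k : Fin 3, ‖EuclideanSpace.basisFun (Fin 3) ℝ k‖ = 1 := fun k => (EuclideanSpace.basisFun (Fin 3) ℝ).orthonormal.norm_eq_one k
  have n2 : ‖(EuclideanSpace.single (2 : Fin 3) (1 : ℝ) : EuclideanSpace ℝ (Fin 3))‖ = 1 := by rw [PiLp.norm_single, norm_one]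
  have nDω : ∀ (x w : EuclideanSpace ℝ (Fin 3)), ‖w‖ = 1 → ‖fderiv ℝ (curl v) x w‖ ≤ 4 * ‖iteratedFDeriv ℝ 2 v x‖ := fun x w hw => by
    have h := norm_iteratedFDeriv_curl_le_four hv 1 x
    rw [← norm_iteratedFDeriv_fderiv, norm_iteratedFDeriv_zero] at h
    exact ((fderiv ℝ (curl v) x).le_opNorm w).trans (by rw [hw, mul_one]; exact h)
  have nDB : ∀ (x w : EuclideanSpace ℝ (Fin 3)), ‖w‖ = 1 → ‖fderiv ℝ (fun z : EuclideanSpace ℝ (Fin 3) => (-(v z - c) 1) • EuclideanSpace.single (0 : Fin 3) (1 : ℝ) + ((v z - c) 0) • EuclideanSpace.single (1 : Fin 3) (1 : ℝ)) x w‖ ≤ ‖fderiv ℝ v x‖ := fun x w hw => by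
    have h := norm_fderiv_crossField_apply_le (V := fun z => v z - c) hVsd x w
    rw [fderiv_sub_const] at h
    exact h.trans (by simpa [hw] using (fderiv ℝ v x).le_opNorm w)
  have nDDB : ∀ (x w u : EuclideanSpace ℝ (Fin 3)), ‖w‖ = 1 → ‖u‖ = 1 → ‖fderiv ℝ (fun y : EuclideanSpace ℝ (Fin 3) => fderiv ℝ (fun z : EuclideanSpace ℝ (Fin 3) => (-(v z - c) 1) • EuclideanSpace.single (0 : Fin 3) (1 : ℝ) + ((v z - c) 0) • EuclideanSpace.single (1 : Fin 3) (1 : ℝ)) y w) x u‖ ≤ ‖iteratedFDeriv ℝ 2 v x‖ := fun x w u hw hu => by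
    rw [fderiv_fderiv_crossField_apply (V := fun z => v z - c) hVs2 x w u]
    refine (norm_cross_le _).trans ?_
    simp only [fderiv_sub_const]
    rw [fderiv_fderiv_apply_eq hv2 x]
    have e1 : ‖fderiv ℝ (fderiv ℝ v) x‖ = ‖iteratedFDeriv ℝ 2 v x‖ := by
      rw [← norm_iteratedFDeriv_zero (𝕜 := ℝ) (f := fderiv ℝ (fderiv ℝ v)), norm_iteratedFDeriv_fderiv, norm_iteratedFDeriv_fderiv]
    calc ‖fderiv ℝ (fderiv ℝ v) x w u‖ ≤ ‖fderiv ℝ (fderiv ℝ v) x w‖ * ‖u‖ := (fderiv ℝ (fderiv ℝ v) x w).le_opNorm u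
      _ ≤ ‖fderiv ℝ (fderiv ℝ v) x‖ * ‖w‖ * ‖u‖ := mul_le_mul_of_nonneg_right ((fderiv ℝ (fderiv ℝ v) x).le_opNorm w) (norm_nonneg _)
      _ = ‖iteratedFDeriv ℝ 2 v x‖ := by rw [hw, hu, mul_one, mul_one, e1]
  have nHv : ∀ (x w u : EuclideanSpace ℝ (Fin 3)), ‖w‖ = 1 → ‖u‖ = 1 → ‖fderiv ℝ (fun y => fderiv ℝ v y w) x u‖ ≤ ‖iteratedFDeriv ℝ 2 v x‖ := fun x w u hw hu => by
    rw [fderiv_fderiv_apply_eq hv2 x]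
    have e1 : ‖fderiv ℝ (fderiv ℝ v) x‖ = ‖iteratedFDeriv ℝ 2 v x‖ := by
      rw [← norm_iteratedFDeriv_zero (𝕜 := ℝ) (f := fderiv ℝ (fderiv ℝ v)), norm_iteratedFDeriv_fderiv, norm_iteratedFDeriv_fderiv]
    calc ‖fderiv ℝ (fderiv ℝ v) x w u‖ ≤ ‖fderiv ℝ (fderiv ℝ v) x w‖ * ‖u‖ := (fderiv ℝ (fderiv ℝ v) x w).le_opNorm u
      _ ≤ ‖fderiv ℝ (fderiv ℝ v) x‖ * ‖w‖ * ‖u‖ := mul_le_mul_of_nonneg_right ((fderiv ℝ (fderiv ℝ v) x).le_opNorm w) (norm_nonneg _)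
      _ = ‖iteratedFDeriv ℝ 2 v x‖ := by rw [hw, hu, mul_one, mul_one, e1]
  have nDv : ∀ (x w : EuclideanSpace ℝ (Fin 3)), ‖w‖ = 1 → ‖fderiv ℝ v x w‖ ≤ ‖fderiv ℝ v x‖ := fun x w hw => by simpa [hw] using (fderiv ℝ v x).le_opNorm w
  have nB : ∀ x : EuclideanSpace ℝ (Fin 3), ‖(-(v x - c) 1) • EuclideanSpace.single (0 : Fin 3) (1 : ℝ) + ((v x - c) 0) • EuclideanSpace.single (1 : Fin 3) (1 : ℝ)‖ ≤ ‖v x - c‖ := fun x => norm_cross_le (v x - c)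
  have ac : ∀ (z : EuclideanSpace ℝ (Fin 3)) (i : Fin 3), |z i| ≤ ‖z‖ := fun z i => abs_apply_le_norm z i
  have hslab3 : ∀ x : EuclideanSpace ℝ (Fin 3), deriv (deriv (deriv g)) (x 2) ≠ 0 → {x : EuclideanSpace ℝ (Fin 3) | |x 2| ≤ T}.indicator (fun x => ‖v x - c‖ ^ 2) x = ‖v x - c‖ ^ 2 := fun x hx => by
    have hxT : |x 2| ≤ T := by
      by_contra h; exact hx (hT3 _ (not_le.1 h).le)
    exact Set.indicator_of_mem (show x ∈ {x : EuclideanSpace ℝ (Fin 3) | |x 2| ≤ T} from hxT) _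
  -- integrability of the nine densities
  have iP1 : Integrable (fun x : EuclideanSpace ℝ (Fin 3) => deriv g (x 2) * frobeniusNormSq (fderiv ℝ (curl v) x)) volume := by
    refine (iQ2.const_mul (K1 * 48)).mono' (cg1.mul cDωF).aestronglyMeasurable (Eventually.of_forall fun x => ?_)
    rw [Real.norm_eq_abs, abs_mul, abs_of_nonneg (frobeniusNormSq_nonneg _)]
    have hF : frobeniusNormSq (fderiv ℝ (curl v) x) ≤ 48 * ‖iteratedFDeriv ℝ 2 v x‖ ^ 2 := by
      rw [frobeniusNormSq_eq_sum (EuclideanSpace.basisFun (Fin 3) ℝ)]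
      calc ∑ i : Fin 3, ‖fderiv ℝ (curl v) x (EuclideanSpace.basisFun (Fin 3) ℝ i)‖ ^ 2 ≤ ∑ i : Fin 3, (4 * ‖iteratedFDeriv ℝ 2 v x‖) ^ 2 :=
            Finset.sum_le_sum fun i _ => pow_le_pow_left₀ (norm_nonneg _) (nDω x _ (nb i)) 2
        _ = 48 * ‖iteratedFDeriv ℝ 2 v x‖ ^ 2 := by simp; ring
    calc |deriv g (x 2)| * frobeniusNormSq (fderiv ℝ (curl v) x) ≤ K1 * (48 * ‖iteratedFDeriv ℝ 2 v x‖ ^ 2) :=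
          mul_le_mul (hK1 _) hF (frobeniusNormSq_nonneg _) hK10
      _ = K1 * 48 * ‖iteratedFDeriv ℝ 2 v x‖ ^ 2 := by ring
  have iD2 : Integrable (fun x : EuclideanSpace ℝ (Fin 3) => deriv (deriv g) (x 2) * ⟪fderiv ℝ (curl v) x (EuclideanSpace.single (2 : Fin 3) (1 : ℝ)), curl v x⟫) volume := by
    refine ((iQ2.const_mul (K2 * 4)).add (iW2.const_mul K2)).mono' (cg2.mul ((cDω _).inner cω)).aestronglyMeasurable
      (Eventually.of_forall fun x => ?_)
    simp only [Pi.add_apply]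
    rw [Real.norm_eq_abs, abs_mul]
    have h := abs_real_inner_le_norm (fderiv ℝ (curl v) x (EuclideanSpace.single (2 : Fin 3) (1 : ℝ))) (curl v x)
    have a1 := nDω x _ n2; have hQ := norm_nonneg (iteratedFDeriv ℝ 2 v x); have hW := norm_nonneg (curl v x)
    have : ‖fderiv ℝ (curl v) x (EuclideanSpace.single (2 : Fin 3) (1 : ℝ))‖ * ‖curl v x‖ ≤ 4 * ‖iteratedFDeriv ℝ 2 v x‖ ^ 2 + ‖curl v x‖ ^ 2 := by
      nlinarith [sq_nonneg (2 * ‖iteratedFDeriv ℝ 2 v x‖ - ‖curl v x‖), mul_le_mul_of_nonneg_right a1 hW]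
    nlinarith [mul_le_mul (hK2 (x 2)) (h.trans this) (abs_nonneg _) hK20]
  have iD3 : Integrable (fun x : EuclideanSpace ℝ (Fin 3) => deriv g (x 2) * ‖fderiv ℝ (curl v) x (EuclideanSpace.single (2 : Fin 3) (1 : ℝ))‖ ^ 2) volume := by
    refine (iQ2.const_mul (K1 * 16)).mono' (cg1.mul ((cDω _).norm.pow 2)).aestronglyMeasurable (Eventually.of_forall fun x => ?_)
    rw [Real.norm_eq_abs, abs_mul, abs_of_nonneg (sq_nonneg ‖fderiv ℝ (curl v) x (EuclideanSpace.single (2 : Fin 3) (1 : ℝ))‖)]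
    have a1 := pow_le_pow_left₀ (norm_nonneg _) (nDω x _ n2) 2
    nlinarith [mul_le_mul (hK1 (x 2)) a1 (sq_nonneg _) hK10]
  have iD4 : Integrable (fun x : EuclideanSpace ℝ (Fin 3) => deriv (deriv (deriv g)) (x 2) * ⟪fderiv ℝ (curl v) x (EuclideanSpace.single (2 : Fin 3) (1 : ℝ)),
          (-(v x - c) 1) • EuclideanSpace.single (0 : Fin 3) (1 : ℝ) + ((v x - c) 0) • EuclideanSpace.single (1 : Fin 3) (1 : ℝ)⟫) volume := by
    refine ((iQ2.const_mul (K3 * 4)).add (hslab.const_mul K3)).mono' (cg3.mul ((cDω _).inner cB)).aestronglyMeasurable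
      (Eventually.of_forall fun x => ?_)
    simp only [Pi.add_apply]
    rw [Real.norm_eq_abs, abs_mul]
    by_cases h0 : deriv (deriv (deriv g)) (x 2) = 0
    · rw [h0, abs_zero, zero_mul]
      have : 0 ≤ {x : EuclideanSpace ℝ (Fin 3) | |x 2| ≤ T}.indicator (fun x => ‖v x - c‖ ^ 2) x := Set.indicator_nonneg (fun y _ => sq_nonneg _) x
      positivity
    rw [hslab3 x h0]
    have h := abs_real_inner_le_norm (fderiv ℝ (curl v) x (EuclideanSpace.single (2 : Fin 3) (1 : ℝ))) ((-(v x - c) 1) • EuclideanSpace.single (0 : Fin 3) (1 : ℝ) + ((v x - c) 0) • EuclideanSpace.single (1 : Fin 3) (1 : ℝ))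
    have a1 := nDω x _ n2; have a2 := nB x; have hQ := norm_nonneg (iteratedFDeriv ℝ 2 v x); have hY := norm_nonneg (v x - c)
    have : ‖fderiv ℝ (curl v) x (EuclideanSpace.single (2 : Fin 3) (1 : ℝ))‖ * ‖(-(v x - c) 1) • EuclideanSpace.single (0 : Fin 3) (1 : ℝ) + ((v x - c) 0) • EuclideanSpace.single (1 : Fin 3) (1 : ℝ)‖ ≤ 4 * ‖iteratedFDeriv ℝ 2 v x‖ ^ 2 + ‖v x - c‖ ^ 2 := by
      nlinarith [sq_nonneg (2 * ‖iteratedFDeriv ℝ 2 v x‖ - ‖v x - c‖), mul_le_mul a1 a2 (norm_nonneg _) (by positivity)]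
    nlinarith [mul_le_mul (hK3 (x 2)) (h.trans this) (abs_nonneg _) hK30]
  have iD5 : Integrable (fun x : EuclideanSpace ℝ (Fin 3) => deriv (deriv g) (x 2) * ⟪fderiv ℝ (curl v) x (EuclideanSpace.single (2 : Fin 3) (1 : ℝ)),
          fderiv ℝ (fun z : EuclideanSpace ℝ (Fin 3) => (-(v z - c) 1) • EuclideanSpace.single (0 : Fin 3) (1 : ℝ) + ((v z - c) 0) • EuclideanSpace.single (1 : Fin 3) (1 : ℝ)) x
            (EuclideanSpace.single (2 : Fin 3) (1 : ℝ))⟫) volume := by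
    refine ((iQ2.const_mul (K2 * 4)).add (iP2.const_mul K2)).mono' (cg2.mul ((cDω _).inner (cDB _))).aestronglyMeasurable
      (Eventually.of_forall fun x => ?_)
    simp only [Pi.add_apply]
    rw [Real.norm_eq_abs, abs_mul]
    have h := abs_real_inner_le_norm (fderiv ℝ (curl v) x (EuclideanSpace.single (2 : Fin 3) (1 : ℝ))) (fderiv ℝ (fun z : EuclideanSpace ℝ (Fin 3) => (-(v z - c) 1) • EuclideanSpace.single (0 : Fin 3) (1 : ℝ) + ((v z - c) 0) • EuclideanSpace.single (1 : Fin 3) (1 : ℝ)) x (EuclideanSpace.single (2 : Fin 3) (1 : ℝ)))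
    have a1 := nDω x _ n2; have a2 := nDB x _ n2; have hQ := norm_nonneg (iteratedFDeriv ℝ 2 v x); have hP := norm_nonneg (fderiv ℝ v x)
    have : ‖fderiv ℝ (curl v) x (EuclideanSpace.single (2 : Fin 3) (1 : ℝ))‖ * ‖fderiv ℝ (fun z : EuclideanSpace ℝ (Fin 3) => (-(v z - c) 1) • EuclideanSpace.single (0 : Fin 3) (1 : ℝ) + ((v z - c) 0) • EuclideanSpace.single (1 : Fin 3) (1 : ℝ)) x (EuclideanSpace.single (2 : Fin 3) (1 : ℝ))‖ ≤ 4 * ‖iteratedFDeriv ℝ 2 v x‖ ^ 2 + ‖fderiv ℝ v x‖ ^ 2 := by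
      nlinarith [sq_nonneg (2 * ‖iteratedFDeriv ℝ 2 v x‖ - ‖fderiv ℝ v x‖), mul_le_mul a1 a2 (norm_nonneg _) (by positivity)]
    nlinarith [mul_le_mul (hK2 (x 2)) (h.trans this) (abs_nonneg _) hK20]
  have iD6 : Integrable (fun x : EuclideanSpace ℝ (Fin 3) => ∑ i : Fin 3, deriv (deriv g) (x 2) * ⟪fderiv ℝ (curl v) x (EuclideanSpace.basisFun (Fin 3) ℝ i),
            fderiv ℝ (fun z : EuclideanSpace ℝ (Fin 3) => (-(v z - c) 1) • EuclideanSpace.single (0 : Fin 3) (1 : ℝ) + ((v z - c) 0) • EuclideanSpace.single (1 : Fin 3) (1 : ℝ)) x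
              (EuclideanSpace.basisFun (Fin 3) ℝ i)⟫) volume := by
    refine integrable_finsetSum _ fun i _ => ?_
    refine ((iQ2.const_mul (K2 * 4)).add (iP2.const_mul K2)).mono' (cg2.mul ((cDω _).inner (cDB _))).aestronglyMeasurable
      (Eventually.of_forall fun x => ?_)
    simp only [Pi.add_apply]
    rw [Real.norm_eq_abs, abs_mul]
    have h := abs_real_inner_le_norm (fderiv ℝ (curl v) x (EuclideanSpace.basisFun (Fin 3) ℝ i)) (fderiv ℝ (fun z : EuclideanSpace ℝ (Fin 3) => (-(v z - c) 1) • EuclideanSpace.single (0 : Fin 3) (1 : ℝ) + ((v z - c) 0) • EuclideanSpace.single (1 : Fin 3) (1 : ℝ)) x (EuclideanSpace.basisFun (Fin 3) ℝ i))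
    have a1 := nDω x _ (nb i); have a2 := nDB x _ (nb i); have hQ := norm_nonneg (iteratedFDeriv ℝ 2 v x); have hP := norm_nonneg (fderiv ℝ v x)
    have : ‖fderiv ℝ (curl v) x (EuclideanSpace.basisFun (Fin 3) ℝ i)‖ * ‖fderiv ℝ (fun z : EuclideanSpace ℝ (Fin 3) => (-(v z - c) 1) • EuclideanSpace.single (0 : Fin 3) (1 : ℝ) + ((v z - c) 0) • EuclideanSpace.single (1 : Fin 3) (1 : ℝ)) x (EuclideanSpace.basisFun (Fin 3) ℝ i)‖ ≤ 4 * ‖iteratedFDeriv ℝ 2 v x‖ ^ 2 + ‖fderiv ℝ v x‖ ^ 2 := by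
      nlinarith [sq_nonneg (2 * ‖iteratedFDeriv ℝ 2 v x‖ - ‖fderiv ℝ v x‖), mul_le_mul a1 a2 (norm_nonneg _) (by positivity)]
    nlinarith [mul_le_mul (hK2 (x 2)) (h.trans this) (abs_nonneg _) hK20]
  have iD7 : Integrable (fun x : EuclideanSpace ℝ (Fin 3) => ∑ i : Fin 3, deriv g (x 2) * ⟪fderiv ℝ (curl v) x (EuclideanSpace.basisFun (Fin 3) ℝ i),
            fderiv ℝ (fun y : EuclideanSpace ℝ (Fin 3) => fderiv ℝ (fun z : EuclideanSpace ℝ (Fin 3) => (-(v z - c) 1) • EuclideanSpace.single (0 : Fin 3) (1 : ℝ) + ((v z - c) 0) • EuclideanSpace.single (1 : Fin 3) (1 : ℝ)) y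
              (EuclideanSpace.basisFun (Fin 3) ℝ i)) x (EuclideanSpace.single (2 : Fin 3) (1 : ℝ))⟫) volume := by
    refine integrable_finsetSum _ fun i _ => ?_
    refine (iQ2.const_mul (K1 * 4)).mono' (cg1.mul ((cDω _).inner (cDDB _ _))).aestronglyMeasurable (Eventually.of_forall fun x => ?_)
    rw [Real.norm_eq_abs, abs_mul]
    have h := abs_real_inner_le_norm (fderiv ℝ (curl v) x (EuclideanSpace.basisFun (Fin 3) ℝ i)) (fderiv ℝ (fun y : EuclideanSpace ℝ (Fin 3) => fderiv ℝ (fun z : EuclideanSpace ℝ (Fin 3) => (-(v z - c) 1) • EuclideanSpace.single (0 : Fin 3) (1 : ℝ) + ((v z - c) 0) • EuclideanSpace.single (1 : Fin 3) (1 : ℝ)) y (EuclideanSpace.basisFun (Fin 3) ℝ i)) x (EuclideanSpace.single (2 : Fin 3) (1 : ℝ)))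
    have a1 := nDω x _ (nb i); have a2 := nDDB x _ _ (nb i) n2; have hQ := norm_nonneg (iteratedFDeriv ℝ 2 v x)
    have : ‖fderiv ℝ (curl v) x (EuclideanSpace.basisFun (Fin 3) ℝ i)‖ * ‖fderiv ℝ (fun y : EuclideanSpace ℝ (Fin 3) => fderiv ℝ (fun z : EuclideanSpace ℝ (Fin 3) => (-(v z - c) 1) • EuclideanSpace.single (0 : Fin 3) (1 : ℝ) + ((v z - c) 0) • EuclideanSpace.single (1 : Fin 3) (1 : ℝ)) y (EuclideanSpace.basisFun (Fin 3) ℝ i)) x (EuclideanSpace.single (2 : Fin 3) (1 : ℝ))‖ ≤ 4 * ‖iteratedFDeriv ℝ 2 v x‖ ^ 2 := by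
      nlinarith [mul_le_mul a1 a2 (norm_nonneg _) (by positivity)]
    nlinarith [mul_le_mul (hK1 (x 2)) (h.trans this) (abs_nonneg _) hK10]
  have iD8 : Integrable (fun x : EuclideanSpace ℝ (Fin 3) => deriv (deriv g) (x 2) * (fderiv ℝ (curl v) x (EuclideanSpace.single (2 : Fin 3) (1 : ℝ)) 0 * fderiv ℝ v x (EuclideanSpace.single (1 : Fin 3) (1 : ℝ)) 2 -
          fderiv ℝ (curl v) x (EuclideanSpace.single (2 : Fin 3) (1 : ℝ)) 1 * fderiv ℝ v x (EuclideanSpace.single (0 : Fin 3) (1 : ℝ)) 2)) volume := by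
    refine ((iQ2.const_mul (K2 * 8)).add (iP2.const_mul (K2 * 2))).mono'
      (cg2.mul (((cco 0 (cDω _)).mul (cco 2 (cDv _))).sub ((cco 1 (cDω _)).mul (cco 2 (cDv _))))).aestronglyMeasurable
      (Eventually.of_forall fun x => ?_)
    simp only [Pi.add_apply]
    rw [Real.norm_eq_abs, abs_mul]
    have h := abs_slideCoeff_density_le (V := v) x
    have a1 := nDω x _ n2; have hQ := norm_nonneg (iteratedFDeriv ℝ 2 v x); have hP := norm_nonneg (fderiv ℝ v x)
    have : 2 * ‖fderiv ℝ (curl v) x (EuclideanSpace.single (2 : Fin 3) (1 : ℝ))‖ * ‖fderiv ℝ v x‖ ≤ 8 * ‖iteratedFDeriv ℝ 2 v x‖ ^ 2 + 2 * ‖fderiv ℝ v x‖ ^ 2 := by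
      nlinarith [sq_nonneg (2 * ‖iteratedFDeriv ℝ 2 v x‖ - ‖fderiv ℝ v x‖), mul_le_mul_of_nonneg_right a1 hP]
    nlinarith [mul_le_mul (hK2 (x 2)) (h.trans this) (abs_nonneg _) hK20]
  have iD9 : Integrable (fun x : EuclideanSpace ℝ (Fin 3) => deriv g (x 2) * ∑ i : Fin 3, (fderiv ℝ (curl v) x (EuclideanSpace.basisFun (Fin 3) ℝ i) 0 *
            fderiv ℝ (fun y => fderiv ℝ v y (EuclideanSpace.single (1 : Fin 3) (1 : ℝ))) x (EuclideanSpace.basisFun (Fin 3) ℝ i) 2 -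
          fderiv ℝ (curl v) x (EuclideanSpace.basisFun (Fin 3) ℝ i) 1 *
            fderiv ℝ (fun y => fderiv ℝ v y (EuclideanSpace.single (0 : Fin 3) (1 : ℝ))) x (EuclideanSpace.basisFun (Fin 3) ℝ i) 2)) volume := by
    refine (iQ2.const_mul (K1 * 24)).mono' (cg1.mul (continuous_finsetSum _ fun i _ =>
      ((cco 0 (cDω _)).mul (cco 2 (cHv _ _))).sub ((cco 1 (cDω _)).mul (cco 2 (cHv _ _))))).aestronglyMeasurable
      (Eventually.of_forall fun x => ?_)
    rw [Real.norm_eq_abs, abs_mul]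
    have hQ := norm_nonneg (iteratedFDeriv ℝ 2 v x)
    have hk : ∀ i : Fin 3, |fderiv ℝ (curl v) x (EuclideanSpace.basisFun (Fin 3) ℝ i) 0 *
            fderiv ℝ (fun y => fderiv ℝ v y (EuclideanSpace.single (1 : Fin 3) (1 : ℝ))) x (EuclideanSpace.basisFun (Fin 3) ℝ i) 2 -
          fderiv ℝ (curl v) x (EuclideanSpace.basisFun (Fin 3) ℝ i) 1 *
            fderiv ℝ (fun y => fderiv ℝ v y (EuclideanSpace.single (0 : Fin 3) (1 : ℝ))) x (EuclideanSpace.basisFun (Fin 3) ℝ i) 2| ≤ 8 * ‖iteratedFDeriv ℝ 2 v x‖ ^ 2 := fun i => by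
      have a1 := nDω x _ (nb i)
      have b0 : |fderiv ℝ (curl v) x (EuclideanSpace.basisFun (Fin 3) ℝ i) 0| ≤ 4 * ‖iteratedFDeriv ℝ 2 v x‖ := (ac _ 0).trans a1
      have b1 : |fderiv ℝ (curl v) x (EuclideanSpace.basisFun (Fin 3) ℝ i) 1| ≤ 4 * ‖iteratedFDeriv ℝ 2 v x‖ := (ac _ 1).trans a1
      have c1 : |fderiv ℝ (fun y => fderiv ℝ v y (EuclideanSpace.single (1 : Fin 3) (1 : ℝ))) x (EuclideanSpace.basisFun (Fin 3) ℝ i) 2| ≤ ‖iteratedFDeriv ℝ 2 v x‖ := (ac _ 2).trans (nHv x _ _ (by rw [PiLp.norm_single, norm_one]) (nb i))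
      have c0 : |fderiv ℝ (fun y => fderiv ℝ v y (EuclideanSpace.single (0 : Fin 3) (1 : ℝ))) x (EuclideanSpace.basisFun (Fin 3) ℝ i) 2| ≤ ‖iteratedFDeriv ℝ 2 v x‖ := (ac _ 2).trans (nHv x _ _ (by rw [PiLp.norm_single, norm_one]) (nb i))
      refine (abs_sub _ _).trans ?_
      rw [abs_mul, abs_mul]
      nlinarith [mul_le_mul b0 c1 (abs_nonneg _) (by positivity), mul_le_mul b1 c0 (abs_nonneg _) (by positivity)]
    have hs : |∑ i : Fin 3, (fderiv ℝ (curl v) x (EuclideanSpace.basisFun (Fin 3) ℝ i) 0 *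
            fderiv ℝ (fun y => fderiv ℝ v y (EuclideanSpace.single (1 : Fin 3) (1 : ℝ))) x (EuclideanSpace.basisFun (Fin 3) ℝ i) 2 -
          fderiv ℝ (curl v) x (EuclideanSpace.basisFun (Fin 3) ℝ i) 1 *
            fderiv ℝ (fun y => fderiv ℝ v y (EuclideanSpace.single (0 : Fin 3) (1 : ℝ))) x (EuclideanSpace.basisFun (Fin 3) ℝ i) 2)| ≤ 24 * ‖iteratedFDeriv ℝ 2 v x‖ ^ 2 :=
      (Finset.abs_sum_le_sum_abs _ _).trans ((Finset.sum_le_sum fun i _ => hk i).trans (by simp; ring_nf; rfl))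
    nlinarith [mul_le_mul (hK1 (x 2)) hs (abs_nonneg _) hK10]
  -- split the two integrals
  have e67 : (fun x : EuclideanSpace ℝ (Fin 3) => ∑ i : Fin 3, (deriv (deriv g) (x 2) * ⟪fderiv ℝ (curl v) x (EuclideanSpace.basisFun (Fin 3) ℝ i),
            fderiv ℝ (fun z : EuclideanSpace ℝ (Fin 3) => (-(v z - c) 1) • EuclideanSpace.single (0 : Fin 3) (1 : ℝ) + ((v z - c) 0) • EuclideanSpace.single (1 : Fin 3) (1 : ℝ)) x
              (EuclideanSpace.basisFun (Fin 3) ℝ i)⟫ +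
          deriv g (x 2) * ⟪fderiv ℝ (curl v) x (EuclideanSpace.basisFun (Fin 3) ℝ i),
            fderiv ℝ (fun y : EuclideanSpace ℝ (Fin 3) => fderiv ℝ (fun z : EuclideanSpace ℝ (Fin 3) => (-(v z - c) 1) • EuclideanSpace.single (0 : Fin 3) (1 : ℝ) + ((v z - c) 0) • EuclideanSpace.single (1 : Fin 3) (1 : ℝ)) y
              (EuclideanSpace.basisFun (Fin 3) ℝ i)) x (EuclideanSpace.single (2 : Fin 3) (1 : ℝ))⟫)) = fun x => (∑ i : Fin 3, deriv (deriv g) (x 2) * ⟪fderiv ℝ (curl v) x (EuclideanSpace.basisFun (Fin 3) ℝ i),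
            fderiv ℝ (fun z : EuclideanSpace ℝ (Fin 3) => (-(v z - c) 1) • EuclideanSpace.single (0 : Fin 3) (1 : ℝ) + ((v z - c) 0) • EuclideanSpace.single (1 : Fin 3) (1 : ℝ)) x
              (EuclideanSpace.basisFun (Fin 3) ℝ i)⟫) + ∑ i : Fin 3, deriv g (x 2) * ⟪fderiv ℝ (curl v) x (EuclideanSpace.basisFun (Fin 3) ℝ i),
            fderiv ℝ (fun y : EuclideanSpace ℝ (Fin 3) => fderiv ℝ (fun z : EuclideanSpace ℝ (Fin 3) => (-(v z - c) 1) • EuclideanSpace.single (0 : Fin 3) (1 : ℝ) + ((v z - c) 0) • EuclideanSpace.single (1 : Fin 3) (1 : ℝ)) y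
              (EuclideanSpace.basisFun (Fin 3) ℝ i)) x (EuclideanSpace.single (2 : Fin 3) (1 : ℝ))⟫ := by
    funext x; rw [← Finset.sum_add_distrib]
  have i23 : Integrable (fun x : EuclideanSpace ℝ (Fin 3) => deriv (deriv g) (x 2) * ⟪fderiv ℝ (curl v) x (EuclideanSpace.single (2 : Fin 3) (1 : ℝ)), curl v x⟫ + deriv g (x 2) * ‖fderiv ℝ (curl v) x (EuclideanSpace.single (2 : Fin 3) (1 : ℝ))‖ ^ 2) volume := iD2.add iD3
  have i234 : Integrable (fun x : EuclideanSpace ℝ (Fin 3) => deriv (deriv g) (x 2) * ⟪fderiv ℝ (curl v) x (EuclideanSpace.single (2 : Fin 3) (1 : ℝ)), curl v x⟫ + deriv g (x 2) * ‖fderiv ℝ (curl v) x (EuclideanSpace.single (2 : Fin 3) (1 : ℝ))‖ ^ 2 + deriv (deriv (deriv g)) (x 2) * ⟪fderiv ℝ (curl v) x (EuclideanSpace.single (2 : Fin 3) (1 : ℝ)),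
          (-(v x - c) 1) • EuclideanSpace.single (0 : Fin 3) (1 : ℝ) + ((v x - c) 0) • EuclideanSpace.single (1 : Fin 3) (1 : ℝ)⟫) volume := i23.add iD4
  have i2345 : Integrable (fun x : EuclideanSpace ℝ (Fin 3) => deriv (deriv g) (x 2) * ⟪fderiv ℝ (curl v) x (EuclideanSpace.single (2 : Fin 3) (1 : ℝ)), curl v x⟫ + deriv g (x 2) * ‖fderiv ℝ (curl v) x (EuclideanSpace.single (2 : Fin 3) (1 : ℝ))‖ ^ 2 + deriv (deriv (deriv g)) (x 2) * ⟪fderiv ℝ (curl v) x (EuclideanSpace.single (2 : Fin 3) (1 : ℝ)),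
          (-(v x - c) 1) • EuclideanSpace.single (0 : Fin 3) (1 : ℝ) + ((v x - c) 0) • EuclideanSpace.single (1 : Fin 3) (1 : ℝ)⟫ + deriv (deriv g) (x 2) * ⟪fderiv ℝ (curl v) x (EuclideanSpace.single (2 : Fin 3) (1 : ℝ)),
          fderiv ℝ (fun z : EuclideanSpace ℝ (Fin 3) => (-(v z - c) 1) • EuclideanSpace.single (0 : Fin 3) (1 : ℝ) + ((v z - c) 0) • EuclideanSpace.single (1 : Fin 3) (1 : ℝ)) x
            (EuclideanSpace.single (2 : Fin 3) (1 : ℝ))⟫) volume := i234.add iD5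
  have i67 : Integrable (fun x : EuclideanSpace ℝ (Fin 3) => ∑ i : Fin 3, (deriv (deriv g) (x 2) * ⟪fderiv ℝ (curl v) x (EuclideanSpace.basisFun (Fin 3) ℝ i),
            fderiv ℝ (fun z : EuclideanSpace ℝ (Fin 3) => (-(v z - c) 1) • EuclideanSpace.single (0 : Fin 3) (1 : ℝ) + ((v z - c) 0) • EuclideanSpace.single (1 : Fin 3) (1 : ℝ)) x
              (EuclideanSpace.basisFun (Fin 3) ℝ i)⟫ +
          deriv g (x 2) * ⟪fderiv ℝ (curl v) x (EuclideanSpace.basisFun (Fin 3) ℝ i),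
            fderiv ℝ (fun y : EuclideanSpace ℝ (Fin 3) => fderiv ℝ (fun z : EuclideanSpace ℝ (Fin 3) => (-(v z - c) 1) • EuclideanSpace.single (0 : Fin 3) (1 : ℝ) + ((v z - c) 0) • EuclideanSpace.single (1 : Fin 3) (1 : ℝ)) y
              (EuclideanSpace.basisFun (Fin 3) ℝ i)) x (EuclideanSpace.single (2 : Fin 3) (1 : ℝ))⟫)) volume := by rw [e67]; exact iD6.add iD7
  have eBig : (∫ x : EuclideanSpace ℝ (Fin 3), deriv (deriv g) (x 2) * ⟪fderiv ℝ (curl v) x (EuclideanSpace.single (2 : Fin 3) (1 : ℝ)), curl v x⟫ + deriv g (x 2) * ‖fderiv ℝ (curl v) x (EuclideanSpace.single (2 : Fin 3) (1 : ℝ))‖ ^ 2 + deriv (deriv (deriv g)) (x 2) * ⟪fderiv ℝ (curl v) x (EuclideanSpace.single (2 : Fin 3) (1 : ℝ)),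
          (-(v x - c) 1) • EuclideanSpace.single (0 : Fin 3) (1 : ℝ) + ((v x - c) 0) • EuclideanSpace.single (1 : Fin 3) (1 : ℝ)⟫ + deriv (deriv g) (x 2) * ⟪fderiv ℝ (curl v) x (EuclideanSpace.single (2 : Fin 3) (1 : ℝ)),
          fderiv ℝ (fun z : EuclideanSpace ℝ (Fin 3) => (-(v z - c) 1) • EuclideanSpace.single (0 : Fin 3) (1 : ℝ) + ((v z - c) 0) • EuclideanSpace.single (1 : Fin 3) (1 : ℝ)) x
            (EuclideanSpace.single (2 : Fin 3) (1 : ℝ))⟫ + ∑ i : Fin 3, (deriv (deriv g) (x 2) * ⟪fderiv ℝ (curl v) x (EuclideanSpace.basisFun (Fin 3) ℝ i),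
            fderiv ℝ (fun z : EuclideanSpace ℝ (Fin 3) => (-(v z - c) 1) • EuclideanSpace.single (0 : Fin 3) (1 : ℝ) + ((v z - c) 0) • EuclideanSpace.single (1 : Fin 3) (1 : ℝ)) x
              (EuclideanSpace.basisFun (Fin 3) ℝ i)⟫ +
          deriv g (x 2) * ⟪fderiv ℝ (curl v) x (EuclideanSpace.basisFun (Fin 3) ℝ i),
            fderiv ℝ (fun y : EuclideanSpace ℝ (Fin 3) => fderiv ℝ (fun z : EuclideanSpace ℝ (Fin 3) => (-(v z - c) 1) • EuclideanSpace.single (0 : Fin 3) (1 : ℝ) + ((v z - c) 0) • EuclideanSpace.single (1 : Fin 3) (1 : ℝ)) y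
              (EuclideanSpace.basisFun (Fin 3) ℝ i)) x (EuclideanSpace.single (2 : Fin 3) (1 : ℝ))⟫)) =
      (∫ x : EuclideanSpace ℝ (Fin 3), deriv (deriv g) (x 2) * ⟪fderiv ℝ (curl v) x (EuclideanSpace.single (2 : Fin 3) (1 : ℝ)), curl v x⟫) + (∫ x : EuclideanSpace ℝ (Fin 3), deriv g (x 2) * ‖fderiv ℝ (curl v) x (EuclideanSpace.single (2 : Fin 3) (1 : ℝ))‖ ^ 2) + (∫ x : EuclideanSpace ℝ (Fin 3), deriv (deriv (deriv g)) (x 2) * ⟪fderiv ℝ (curl v) x (EuclideanSpace.single (2 : Fin 3) (1 : ℝ)),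
          (-(v x - c) 1) • EuclideanSpace.single (0 : Fin 3) (1 : ℝ) + ((v x - c) 0) • EuclideanSpace.single (1 : Fin 3) (1 : ℝ)⟫) + (∫ x : EuclideanSpace ℝ (Fin 3), deriv (deriv g) (x 2) * ⟪fderiv ℝ (curl v) x (EuclideanSpace.single (2 : Fin 3) (1 : ℝ)),
          fderiv ℝ (fun z : EuclideanSpace ℝ (Fin 3) => (-(v z - c) 1) • EuclideanSpace.single (0 : Fin 3) (1 : ℝ) + ((v z - c) 0) • EuclideanSpace.single (1 : Fin 3) (1 : ℝ)) x
            (EuclideanSpace.single (2 : Fin 3) (1 : ℝ))⟫) + ((∫ x : EuclideanSpace ℝ (Fin 3), ∑ i : Fin 3, deriv (deriv g) (x 2) * ⟪fderiv ℝ (curl v) x (EuclideanSpace.basisFun (Fin 3) ℝ i),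
            fderiv ℝ (fun z : EuclideanSpace ℝ (Fin 3) => (-(v z - c) 1) • EuclideanSpace.single (0 : Fin 3) (1 : ℝ) + ((v z - c) 0) • EuclideanSpace.single (1 : Fin 3) (1 : ℝ)) x
              (EuclideanSpace.basisFun (Fin 3) ℝ i)⟫) + (∫ x : EuclideanSpace ℝ (Fin 3), ∑ i : Fin 3, deriv g (x 2) * ⟪fderiv ℝ (curl v) x (EuclideanSpace.basisFun (Fin 3) ℝ i),
            fderiv ℝ (fun y : EuclideanSpace ℝ (Fin 3) => fderiv ℝ (fun z : EuclideanSpace ℝ (Fin 3) => (-(v z - c) 1) • EuclideanSpace.single (0 : Fin 3) (1 : ℝ) + ((v z - c) 0) • EuclideanSpace.single (1 : Fin 3) (1 : ℝ)) y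
              (EuclideanSpace.basisFun (Fin 3) ℝ i)) x (EuclideanSpace.single (2 : Fin 3) (1 : ℝ))⟫)) := by
    rw [integral_add i2345 i67, integral_add i234 iD5, integral_add i23 iD4, integral_add iD2 iD3]
    simp_rw [e67]
    rw [integral_add iD6 iD7]
  have eSmall : (∫ x : EuclideanSpace ℝ (Fin 3), deriv (deriv g) (x 2) * (fderiv ℝ (curl v) x (EuclideanSpace.single (2 : Fin 3) (1 : ℝ)) 0 * fderiv ℝ v x (EuclideanSpace.single (1 : Fin 3) (1 : ℝ)) 2 -
          fderiv ℝ (curl v) x (EuclideanSpace.single (2 : Fin 3) (1 : ℝ)) 1 * fderiv ℝ v x (EuclideanSpace.single (0 : Fin 3) (1 : ℝ)) 2) + deriv g (x 2) * ∑ i : Fin 3, (fderiv ℝ (curl v) x (EuclideanSpace.basisFun (Fin 3) ℝ i) 0 *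
            fderiv ℝ (fun y => fderiv ℝ v y (EuclideanSpace.single (1 : Fin 3) (1 : ℝ))) x (EuclideanSpace.basisFun (Fin 3) ℝ i) 2 -
          fderiv ℝ (curl v) x (EuclideanSpace.basisFun (Fin 3) ℝ i) 1 *
            fderiv ℝ (fun y => fderiv ℝ v y (EuclideanSpace.single (0 : Fin 3) (1 : ℝ))) x (EuclideanSpace.basisFun (Fin 3) ℝ i) 2)) = (∫ x : EuclideanSpace ℝ (Fin 3), deriv (deriv g) (x 2) * (fderiv ℝ (curl v) x (EuclideanSpace.single (2 : Fin 3) (1 : ℝ)) 0 * fderiv ℝ v x (EuclideanSpace.single (1 : Fin 3) (1 : ℝ)) 2 -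
          fderiv ℝ (curl v) x (EuclideanSpace.single (2 : Fin 3) (1 : ℝ)) 1 * fderiv ℝ v x (EuclideanSpace.single (0 : Fin 3) (1 : ℝ)) 2)) + (∫ x : EuclideanSpace ℝ (Fin 3), deriv g (x 2) * ∑ i : Fin 3, (fderiv ℝ (curl v) x (EuclideanSpace.basisFun (Fin 3) ℝ i) 0 *
            fderiv ℝ (fun y => fderiv ℝ v y (EuclideanSpace.single (1 : Fin 3) (1 : ℝ))) x (EuclideanSpace.basisFun (Fin 3) ℝ i) 2 -
          fderiv ℝ (curl v) x (EuclideanSpace.basisFun (Fin 3) ℝ i) 1 *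
            fderiv ℝ (fun y => fderiv ℝ v y (EuclideanSpace.single (0 : Fin 3) (1 : ℝ))) x (EuclideanSpace.basisFun (Fin 3) ℝ i) 2)) := integral_add iD8 iD9
  rw [eBig, eSmall]
  ring

end ExtremiserLiouville

end Summit.NavierStokesRegularity.NavierStokesRegularity.Theorems

end
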